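import Summits.BirchSwinnertonDyer.Rank1Residual.ManinAdditive.RelativeIharaShiftVanishing
import Literature.NumberTheory.Automorphic.CongruenceSubgroupPropertySL2Proofs
import HarnessLib

/-!
# Edges of the leaf `RelativeIharaShiftVanishing` (candidate E-es-25, cell `bsd-f2-manin`): the DIAMOND FUNCTIONS
# `u_η(γ) = η(d_γ mod L')` on `Γ₀(L)` and the PROVED END of the Ihara-free route (es g11, MEMO-es §23):
# «shift-invariant generalised eigenclasses are diamond or Eisenstein» ∧ «T_ℓ u_η = (ℓ+1) u_η» ⟹
# `RelativeIharaShiftVanishingBar p t n` BY NAME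

Planner `bsd-f2-manin-es` g11 (HOME `run/shared/lean/pub/bsd-f2-manin/MEMO-es.md` §23; source
HOME/es/Sketch-es-g11.lean sha16 22a2bea12128fd55 §4, §5 (end lemmas), §8, farm rc 0 · 0 sorries · 0 warnings —
landed here VERBATIM by the typer, theorems and ONE honest definition only; the two remaining unproved inputs E-es-35
`ShiftInvariantIsDiamond p t n` and E-es-33 `HeckeDiamond L L'` appear as HYPOTHESES with their bodies spelled out,
pending the cell refuter's audit R-es-23(a) of those texts and the lead's decision to register them as items; when
they land as `@[conjecture]` leaves the by-name bridge is a one-liner over `relativeIharaShiftVanishingBar_of_diamond_of_heckeDiamond`).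

Contents (namespace `Summit.BirchSwinnertonDyer.Rank1Residual.ManinAdditive`):
* `diamondFun L L' K η : Gamma0 L → Fin 1 → K`, `u_η(γ) = η(d_γ mod L')` — a degree-`0` cochain; for `L' ∣ L` and
  `η` additive on units it is a cocycle = an additive homomorphism `Γ₀(L) → K` (`diamondFun_mem_cocycles`; entries
  `gamma0_c_cast_eq_zero`, `gamma0_d_cast_isUnit`, `gamma0_d_mul_cast`).
* END (PROVED): `eq_zero_or_eq_add_one_of_heckeDiamond` (a generalised `λ`-eigen cocycle on which every `T_ℓ`,
  `ℓ ∉ S`, acts by `ℓ + 1` is `0` or has `λ(ℓ) = ℓ + 1` off `S`), `isEisensteinEigensystem_two_of_eq_add_one` /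
  `…_bar_…` (`λ(ℓ) = ℓ + 1` IS the Eisenstein system `E₂^{1,1}`), `heckeUZ_eq_smul_of_coe`,
  `eq_zero_of_heckeDiamond_of_not_eisenstein`.
* BRIDGE (PROVED): `relativeIharaShiftVanishingBar_of_diamond_of_heckeDiamond (h1) (h2) : RelativeIharaShiftVanishingBar p t n`
  with `h1` = the body of es's E-es-35 `EsG11.ShiftInvariantIsDiamond p t n` and `h2` = `∀ L`, the body of es's E-es-33
  `EsG11.HeckeDiamond L (L / t ^ L.factorization t)`.
No Ihara lemma, no `ribet1984_iharaLemma`, no literature fact is used. Nothing about BSD or Manin's constant is proved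
here; the leaf stays unproved — this file only reduces it to the two named inputs of the «ihara-descent» line.
-/

set_option autoImplicit false

noncomputable section

open scoped MatrixGroups

open CongruenceSubgroup
  Literature.NumberTheory.Automorphic
  Literature.NumberTheory.EllipticCurves.ModularForms
  Literature.NumberTheory.EllipticCurves.ModularForms.HidaCohomology

namespace Summit.BirchSwinnertonDyer.Rank1Residual.ManinAdditive

/-! ## §4  Diamond homomorphisms on `Γ₀(L)` and their Hecke eigenvalue `ℓ + 1` -/

/-- The diamond function `u_η(γ) := η(d_γ mod L')` on `Γ₀(L)` as a degree-`0` cochain. [folklore] -/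
def diamondFun (L L' : ℕ) (K : Type*) [CommRing K] (η : ZMod L' → K) : Gamma0 L → Fin 1 → K :=
  fun γ _ => η ((((γ : SL(2, ℤ)) 1 1 : ℤ) : ZMod L'))

/-- Unfolding `diamondFun`. [folklore] -/
@[simp] theorem diamondFun_apply (L L' : ℕ) (K : Type*) [CommRing K] (η : ZMod L' → K) (γ : Gamma0 L)
    (i : Fin 1) : diamondFun L L' K η γ i = η ((((γ : SL(2, ℤ)) 1 1 : ℤ) : ZMod L')) := rfl

section Diamond

variable {L L' : ℕ} (hL : L' ∣ L)
include hL

/-- For `γ ∈ Γ₀(L)` and `L' ∣ L`: `c_γ ≡ 0 (mod L')`. [folklore] -/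
theorem gamma0_c_cast_eq_zero (γ : Gamma0 L) : ((((γ : SL(2, ℤ)) 1 0 : ℤ) : ZMod L')) = 0 := by
  have h := (Gamma0_mem).1 γ.2
  have h' : (L : ℤ) ∣ ((γ : SL(2, ℤ)) 1 0 : ℤ) := (ZMod.intCast_zmod_eq_zero_iff_dvd _ L).1 h
  exact (ZMod.intCast_zmod_eq_zero_iff_dvd _ L').2 (dvd_trans (Int.natCast_dvd_natCast.2 hL) h')

/-- For `γ ∈ Γ₀(L)` and `L' ∣ L`: `d_γ mod L'` is a unit (`a d ≡ 1`). [folklore] -/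
theorem gamma0_d_cast_isUnit (γ : Gamma0 L) : IsUnit ((((γ : SL(2, ℤ)) 1 1 : ℤ) : ZMod L')) := by
  have hdet := Matrix.SpecialLinearGroup.det_coe (γ : SL(2, ℤ))
  rw [Matrix.det_fin_two] at hdet
  have hc := gamma0_c_cast_eq_zero hL γ
  have e : ((((γ : SL(2, ℤ)) 1 1 : ℤ) : ZMod L')) * ((((γ : SL(2, ℤ)) 0 0 : ℤ) : ZMod L')) = 1 := by
    have := congrArg (fun z : ℤ => (z : ZMod L')) hdet
    simp only [Int.cast_sub, Int.cast_mul, Int.cast_one] at this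
    rw [hc, mul_zero, sub_zero] at this
    rw [mul_comm]; exact this
  exact IsUnit.of_mul_eq_one _ e

/-- `d_{γδ} ≡ d_γ d_δ (mod L')` on `Γ₀(L)`, `L' ∣ L`. [folklore] -/
theorem gamma0_d_mul_cast (γ δ : Gamma0 L) :
    ((((γ * δ : Gamma0 L) : SL(2, ℤ)) 1 1 : ℤ) : ZMod L') =
      ((((γ : SL(2, ℤ)) 1 1 : ℤ) : ZMod L')) * ((((δ : SL(2, ℤ)) 1 1 : ℤ) : ZMod L')) := by
  have e : ((γ * δ : Gamma0 L) : SL(2, ℤ)) = (γ : SL(2, ℤ)) * (δ : SL(2, ℤ)) := rfl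
  rw [e, SL2Rel.mul_apply_two]
  push_cast
  rw [gamma0_c_cast_eq_zero hL γ, zero_mul, zero_add]

/-- **The diamond function is a cocycle (= an additive homomorphism `Γ₀(L) → K`).** [folklore] -/
theorem diamondFun_mem_cocycles {K : Type*} [CommRing K] (η : ZMod L' → K)
    (hη : ∀ a b : ZMod L', IsUnit a → IsUnit b → η (a * b) = η a + η b) :
    diamondFun L L' K η ∈ cocycles 0 L K := by
  rw [mem_cocycles_iff]
  intro γ δ
  funext i
  simp only [diamondFun_apply, Pi.add_apply, act_zero_eq_id, LinearMap.id_apply]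
  rw [gamma0_d_mul_cast hL, hη _ _ (gamma0_d_cast_isUnit hL γ) (gamma0_d_cast_isUnit hL δ)]
  exact add_comm _ _

end Diamond

/-! ## The end of the argument (es §5, PROVED) -/

/-- **The end of the argument (PROVED).**  A generalised `λ`-eigen cocycle on which every `T_ℓ` (`ℓ ∉ S`)
acts as the scalar `ℓ + 1` is zero, or `λ(ℓ) = ℓ + 1` for every prime `ℓ ∉ S`. [folklore] -/
theorem eq_zero_or_eq_add_one_of_heckeDiamond {K : Type*} [Field K] {L : ℕ} (S : Finset ℕ)
    (lam : ℕ → K) (u : cocycles 0 L K) (hu : IsHeckeGenEigenvector S lam u)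
    (hd : ∀ (ℓ : ℕ) [NeZero ℓ] (hℓ : ℓ.Prime), ℓ ∉ S → heckeUZ 0 L K hℓ u = ((ℓ : K) + 1) • u) :
    u = 0 ∨ ∀ (ℓ : ℕ) [NeZero ℓ], ℓ.Prime → ℓ ∉ S → lam ℓ = (ℓ : K) + 1 := by
  classical
  by_cases h0 : u = 0
  · exact Or.inl h0
  refine Or.inr fun ℓ _ hℓ hℓS => ?_
  obtain ⟨k, hk⟩ := (isHeckeGenEigenvector_iff S lam u).1 hu ℓ hℓ hℓS
  set T := heckeUZ 0 L K hℓ - lam ℓ • (1 : Module.End K (cocycles 0 L K)) with hT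
  have hT1 : T u = (((ℓ : K) + 1) - lam ℓ) • u := by
    have e : (((ℓ : K) + 1) - lam ℓ) • u = ((ℓ : K) + 1) • u - lam ℓ • u := sub_smul ((ℓ : K) + 1) (lam ℓ) u
    rw [e, hT, LinearMap.sub_apply, hd ℓ hℓ hℓS, LinearMap.smul_apply, Module.End.one_apply]
  have hTk : ∀ m : ℕ, (T ^ m) u = ((((ℓ : K) + 1) - lam ℓ) ^ m) • u := by
    intro m
    induction m with
    | zero => simp
    | succ m ih => rw [pow_succ, Module.End.mul_apply, hT1, map_smul, ih, smul_smul, pow_succ']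
  have hk' : ((((ℓ : K) + 1) - lam ℓ) ^ k) • u = 0 := by rw [← hTk k, hk]
  rcases smul_eq_zero.1 hk' with hc | hu0
  · exact (sub_eq_zero.1 (pow_eq_zero_iff'.1 hc).1).symm
  · exact absurd hu0 h0

/-- `λ(ℓ) = ℓ + 1` off `S` IS the Eisenstein system `E₂^{1,1}` (`ψ = φ = 1` of modulus `1`). [folklore] -/
theorem isEisensteinEigensystem_two_of_eq_add_one {K : Type*} [CommRing K] (S : Finset ℕ) (lam : ℕ → K)
    (h : ∀ ℓ : ℕ, ℓ.Prime → ℓ ∉ S → lam ℓ = (ℓ : K) + 1) : IsEisensteinEigensystem 2 lam := by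
  refine ⟨S, 1, 1, 1, one_pos, fun ℓ hℓ hℓS => ?_⟩
  have h1 : (1 : DirichletCharacter K 1) (ℓ : ZMod 1) = 1 :=
    MulChar.one_apply (isUnit_of_subsingleton ((ℓ : ℕ) : ZMod 1))
  rw [h ℓ hℓ hℓS, h1]
  norm_num [add_comm]

/-- The same read in an algebraic closure (the hypothesis of `EsG10.RelativeIharaShiftVanishingBar`). [folklore] -/
theorem isEisensteinEigensystem_two_bar_of_eq_add_one {K : Type*} [Field K] (S : Finset ℕ) (lam : ℕ → K)
    (h : ∀ ℓ : ℕ, ℓ.Prime → ℓ ∉ S → lam ℓ = (ℓ : K) + 1) :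
    IsEisensteinEigensystem 2 (fun ℓ => algebraMap K (AlgebraicClosure K) (lam ℓ)) :=
  isEisensteinEigensystem_two_of_eq_add_one S _ fun ℓ hℓ hℓS => by
    simp only [h ℓ hℓ hℓS, map_add, map_natCast, map_one]

/-! ## `T_ℓ` as a scalar and the non-Eisenstein end (es §8, PROVED) -/

/-- `T_ℓ` as a scalar on a cocycle, read off the cochain. [folklore] -/
theorem heckeUZ_eq_smul_of_coe {K : Type*} [Field K] {L ℓ : ℕ} [NeZero ℓ] (hℓ : ℓ.Prime)
    (u : cocycles 0 L K) (c : K)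
    (h : heckeU 0 L K hℓ (u : Gamma0 L → Fin 1 → K) = c • (u : Gamma0 L → Fin 1 → K)) :
    heckeUZ 0 L K hℓ u = c • u := by
  apply Subtype.ext
  rw [coe_heckeUZ, h, Submodule.coe_smul]

/-- **The end of E-es-25 (PROVED): under the hypotheses of `RelativeIharaShiftVanishingBar`, a cocycle on which
every `T_ℓ` (`ℓ ∉ S`) acts by `ℓ + 1` is zero** (dichotomy §5 + `λ = 1 + ℓ` is Eisenstein over `K̄`). [folklore] -/
theorem eq_zero_of_heckeDiamond_of_not_eisenstein {K : Type*} [Field K] {L : ℕ} (S : Finset ℕ) (lam : ℕ → K)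
    (u : cocycles 0 L K) (hu : IsHeckeGenEigenvector S lam u)
    (hne : ¬ IsEisensteinEigensystem 2 (fun ℓ => algebraMap K (AlgebraicClosure K) (lam ℓ)))
    (hd : ∀ (ℓ : ℕ) [NeZero ℓ] (hℓ : ℓ.Prime), ℓ ∉ S → heckeUZ 0 L K hℓ u = ((ℓ : K) + 1) • u) : u = 0 := by
  rcases eq_zero_or_eq_add_one_of_heckeDiamond S lam u hu hd with h | h
  · exact h
  · refine absurd (isEisensteinEigensystem_two_bar_of_eq_add_one S lam fun ℓ hℓ hℓS => ?_) hne
    haveI : NeZero ℓ := ⟨hℓ.ne_zero⟩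
    exact h ℓ hℓ hℓS

/-! ## The bridge into the landed leaf (es §8, hypotheses = bodies of E-es-35 / E-es-33) -/

/-- **E-es-35 ∧ E-es-33 ⟹ E-es-25 (the landed leaf `RelativeIharaShiftVanishingBar`, BY NAME on the conclusion).**
`h1` = body of es g11's `ShiftInvariantIsDiamond p t n` (shift-invariant generalised eigenclasses are Eisenstein over
`K̄` or diamond functions of modulus `L' = L / t^{v_t L}`); `h2` = body of `HeckeDiamond L L'` at `L' = L / t^{v_t L}`
for every `L` (`T_ℓ u_η = (ℓ + 1) u_η` for primes `ℓ ∤ L`). Proof = es's `relativeIharaShiftVanishingBar_of_diamond`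
verbatim (HOME/es/Sketch-es-g11.lean 22a2bea12128fd55 §8). [folklore] -/
theorem relativeIharaShiftVanishingBar_of_diamond_of_heckeDiamond {p t n : ℕ}
    (h1 : p.Prime → t.Prime → 1 ≤ n →
      ∀ (K : Type) [Field K] [CharP K p] (L : ℕ) [NeZero L] [NeZero t] (S : Finset ℕ)
        (lam : ℕ → K) (u : cocycles 0 L K),
        (∀ q : ℕ, q.Prime → q ∣ p * t * L → q ∈ S) →
        IsHeckeGenEigenvector S lam u →
        degeneracyPullback 0 L (L * t ^ n) (t ^ n) K dvd_rfl (u : Gamma0 L → Fin 1 → K) =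
          degeneracyPullback 0 L (L * t ^ n) 1 K (by simp) (u : Gamma0 L → Fin 1 → K) →
        IsEisensteinEigensystem 2 (fun ℓ => algebraMap K (AlgebraicClosure K) (lam ℓ)) ∨
          ∃ η : ZMod (L / t ^ (L.factorization t)) → K,
            (∀ a b : ZMod (L / t ^ (L.factorization t)), IsUnit a → IsUnit b → η (a * b) = η a + η b) ∧
            (u : Gamma0 L → Fin 1 → K) = diamondFun L (L / t ^ (L.factorization t)) K η)
    (h2 : ∀ L : ℕ, (L / t ^ (L.factorization t)) ∣ L → ∀ (K : Type) [Field K]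
      (η : ZMod (L / t ^ (L.factorization t)) → K),
      (∀ a b : ZMod (L / t ^ (L.factorization t)), IsUnit a → IsUnit b → η (a * b) = η a + η b) →
      ∀ (ℓ : ℕ) [NeZero ℓ] (hℓ : ℓ.Prime), ¬ ℓ ∣ L →
        heckeU 0 L K hℓ (diamondFun L (L / t ^ (L.factorization t)) K η) =
          ((ℓ : K) + 1) • diamondFun L (L / t ^ (L.factorization t)) K η) :
    RelativeIharaShiftVanishingBar p t n := by
  intro hp ht hn K _ _ L _ _ S lam u hS hu hne hshift
  rcases h1 hp ht hn K L S lam u hS hu hshift with hE | ⟨η, hη, hu'⟩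
  · exact absurd hE hne
  · refine eq_zero_of_heckeDiamond_of_not_eisenstein S lam u hu hne fun ℓ _ hℓ hℓS => ?_
    have hℓL : ¬ ℓ ∣ L := fun hdiv => hℓS (hS ℓ hℓ (dvd_mul_of_dvd_right hdiv _))
    refine heckeUZ_eq_smul_of_coe hℓ u _ ?_
    rw [hu']
    exact h2 L (Nat.div_dvd_of_dvd (Nat.ordProj_dvd L t)) K η hη ℓ hℓ hℓL

end Summit.BirchSwinnertonDyer.Rank1Residual.ManinAdditive

end
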